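import Mathlib
import Summits.ValiantsHypothesis.ValiantsHypothesis.Theorems.FifoMatchingNNNotVPTokenGame
import HarnessLib

/-!
# Route FifoMatching — crux `NNNotVP` (stmt-ValiantsHypothesis-11615), line `division_split`:
# the token game, ACCEPT direction — a nest-free perfect matching from token paths

Companion of `…TokenGame` (framework for the clique gadget of stub A `stub_supportFnHard`; the
design record is the module docstring there).  In the round structure of
`tokenPaths_of_matching` (layers `first`, `act j`, `tok j`, `last`; round-structured availability),

* `matching_of_tokenPaths` — `k` increasing token paths along available arcs give a nest-free
  perfect matching all of whose arcs are available (token arcs, twin arcs of the token-free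
  positions, final arcs), provided the twin arcs and the final arcs are available and `last` is
  increasing;
* `nfpmExists_iff_tokenPaths` — with `tokenPaths_of_matching`: on a round-structured instance over
  `Fin (2n)`, the Boolean function of stub A, `decide (SuppFn (NN n) {a | x a})` (nest-free
  perfect-matching existence, `nfpmExists_eq_true_iff`), is `true` iff `k` non-crossing token
  paths along available arcs exist.

Honest framing: pure combinatorics of nest-free matchings; the gadget is NOT constructed here,
stubs Z / A / B2, the crux `NNNotVP` and `VP ≠ VNP` stay OPEN (NOT proved).  No definitions, no
named facts.
-/

noncomputable section

-- Sub = Summit single-conjunct layout: the duplicated namespace component is mandated by the tree.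
set_option linter.dupNamespace false

namespace Summit.ValiantsHypothesis.ValiantsHypothesis.Theorems.FifoMatching.NNNotVP.DivisionSplit

open Finset Literature.Computability.AlgebraicComplexity
open scoped Classical

section TokenGame

variable {P : Type*} [LinearOrder P] {k R N : ℕ}
variable {first : Fin k → P} {act tok : Fin R → Fin N → P} {last : Fin k → P} {lay : P → ℕ}

/-- **A matching from token paths (the `accept` direction of the token game).**  In the round
structure of `tokenPaths_of_matching`, assume moreover that `last` is increasing, that every twin
arc `act j q → tok j q` and every final arc `tok (R-1) q → last i` is available.  Then `k`
increasing token paths `p j : Fin k → Fin N` along available arcs `first i → act 0 (p 0 i)`,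
`tok j (p j i) → act (j+1) (p (j+1) i)` give a nest-free perfect matching of `P` all of whose arcs
are available: the token arcs, the twin arcs of the positions carrying no token, and the final
arcs `tok (R-1) (p (R-1) i) → last i`. [folklore] -/
theorem matching_of_tokenPaths (hR : 0 < R) (hmono : Monotone lay)
    (h0 : ∀ i, lay (first i) = 0) (hA : ∀ j q, lay (act j q) = 2 * j + 1)
    (hT : ∀ j q, lay (tok j q) = 2 * j + 2) (hL : ∀ i, lay (last i) = 2 * R + 1)
    (hfirst : StrictMono first) (hact : ∀ j, StrictMono (act j)) (htok : ∀ j, StrictMono (tok j))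
    (hlast : StrictMono last)
    (hcov : ∀ a, (∃ i, a = first i) ∨ (∃ j q, a = act j q) ∨ (∃ j q, a = tok j q) ∨ (∃ i, a = last i))
    (x : P × P → Bool)
    (xC : ∀ j q, x (act j q, tok j q) = true)
    (xE : ∀ q i, x (tok ⟨R - 1, by omega⟩ q, last i) = true)
    (p : Fin R → Fin k → Fin N) (hp : ∀ j, StrictMono (p j))
    (hx0 : ∀ i, x (first i, act ⟨0, hR⟩ (p ⟨0, hR⟩ i)) = true)
    (hxS : ∀ (j : Fin R) (h : j.val + 1 < R) (i : Fin k),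
      x (tok j (p j i), act ⟨j.val + 1, h⟩ (p ⟨j.val + 1, h⟩ i)) = true) :
    ∃ M : P → P, (∀ a, M (M a) = a) ∧ (∀ a, M a ≠ a) ∧
      (∀ a b, a < b → b < M b → M b < M a → False) ∧ ∀ a, a < M a → x (a, M a) = true := by
  obtain ⟨R, rfl⟩ : ∃ R', R = R' + 1 := ⟨R - 1, by omega⟩
  classical
  -- injectivity / disjointness of the layer maps
  have hact_inj : ∀ {j j' : Fin (R + 1)} {q q' : Fin N}, act j q = act j' q' → j = j' ∧ q = q' := by
    intro j j' q q' h
    have hl := congrArg lay h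
    rw [hA, hA] at hl
    have hj : j = j' := Fin.ext (by omega)
    subst hj
    exact ⟨rfl, (hact j).injective h⟩
  have htok_inj : ∀ {j j' : Fin (R + 1)} {q q' : Fin N}, tok j q = tok j' q' → j = j' ∧ q = q' := by
    intro j j' q q' h
    have hl := congrArg lay h
    rw [hT, hT] at hl
    have hj : j = j' := Fin.ext (by omega)
    subst hj
    exact ⟨rfl, (htok j).injective h⟩
  have lt_of_lay : ∀ {a b : P}, lay a < lay b → a < b := fun h =>
    lt_of_not_ge fun hle => absurd (hmono hle) (not_le.2 h)
  -- token positions: `Tpos j i` = token `i` in token layer `j`, `Apos j i` = its closer in `act j`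
  let Tpos : ℕ → Fin k → P := fun j i =>
    match j with
    | 0 => first i
    | j' + 1 => if h : j' < R + 1 then tok ⟨j', h⟩ (p ⟨j', h⟩ i) else first i
  let Apos : ℕ → Fin k → P := fun j i =>
    if h : j < R + 1 then act ⟨j, h⟩ (p ⟨j, h⟩ i) else last i
  have hT0 : ∀ i, Tpos 0 i = first i := fun i => rfl
  have hTS : ∀ (j : Fin (R + 1)) i, Tpos (j.val + 1) i = tok j (p j i) := by
    intro j i
    simp only [Tpos, dif_pos j.isLt]
  have hAj : ∀ (j : Fin (R + 1)) i, Apos j.val i = act j (p j i) := by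
    intro j i
    simp only [Apos, dif_pos j.isLt]
  have hAR : ∀ i, Apos (R + 1) i = last i := by
    intro i
    simp only [Apos, dif_neg (lt_irrefl _)]
  -- the matching
  let M : P → P := fun a =>
    if h1 : ∃ i, a = first i then Apos 0 h1.choose
    else if h2 : ∃ jq : Fin (R + 1) × Fin N, a = act jq.1 jq.2 then
      (if h : ∃ i, p h2.choose.1 i = h2.choose.2 then Tpos h2.choose.1.val h.choose
        else tok h2.choose.1 h2.choose.2)
    else if h3 : ∃ jq : Fin (R + 1) × Fin N, a = tok jq.1 jq.2 then
      (if h : ∃ i, p h3.choose.1 i = h3.choose.2 then Apos (h3.choose.1.val + 1) h.choose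
        else act h3.choose.1 h3.choose.2)
    else if h4 : ∃ i, a = last i then Tpos (R + 1) h4.choose
    else a
  -- uniqueness of the representations
  have hc1 : ∀ i (h : ∃ i', first i = first i'), h.choose = i := fun i h =>
    (hfirst.injective h.choose_spec).symm
  have hc4 : ∀ i (h : ∃ i', last i = last i'), h.choose = i := fun i h =>
    (hlast.injective h.choose_spec).symm
  have hc2 : ∀ j q (h : ∃ jq : Fin (R + 1) × Fin N, act j q = act jq.1 jq.2), h.choose = (j, q) := by
    intro j q h
    obtain ⟨h1, h2⟩ := hact_inj h.choose_spec
    exact Prod.ext h1.symm h2.symm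
  have hc3 : ∀ j q (h : ∃ jq : Fin (R + 1) × Fin N, tok j q = tok jq.1 jq.2), h.choose = (j, q) := by
    intro j q h
    obtain ⟨h1, h2⟩ := htok_inj h.choose_spec
    exact Prod.ext h1.symm h2.symm
  have hcp : ∀ j i (h : ∃ i', p j i' = p j i), h.choose = i := fun j i h =>
    (hp j).injective h.choose_spec
  -- disjointness facts
  have nAF : ∀ j q, ¬ ∃ i, act j q = first i := fun j q ⟨i, h⟩ => by
    have := congrArg lay h; rw [hA, h0] at this; omega
  have nTF : ∀ j q, ¬ ∃ i, tok j q = first i := fun j q ⟨i, h⟩ => by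
    have := congrArg lay h; rw [hT, h0] at this; omega
  have nTA : ∀ j q, ¬ ∃ jq : Fin (R + 1) × Fin N, tok j q = act jq.1 jq.2 := fun j q ⟨jq, h⟩ => by
    have := congrArg lay h; rw [hT, hA] at this; omega
  have nLF : ∀ i, ¬ ∃ i', last i = first i' := fun i ⟨i', h⟩ => by
    have := congrArg lay h; rw [hL, h0] at this; omega
  have nLA : ∀ i, ¬ ∃ jq : Fin (R + 1) × Fin N, last i = act jq.1 jq.2 := fun i ⟨jq, h⟩ => by
    have := congrArg lay h; rw [hL, hA] at this; have := jq.1.isLt; omega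
  have nLT : ∀ i, ¬ ∃ jq : Fin (R + 1) × Fin N, last i = tok jq.1 jq.2 := fun i ⟨jq, h⟩ => by
    have := congrArg lay h; rw [hL, hT] at this; have := jq.1.isLt; omega
  -- values of `M`
  have hMfirst : ∀ i, M (first i) = act ⟨0, hR⟩ (p ⟨0, hR⟩ i) := by
    intro i
    have e1 : ∃ i', first i = first i' := ⟨i, rfl⟩
    simp only [M, dif_pos e1]
    rw [hc1 i e1]
    exact hAj ⟨0, hR⟩ i
  have hMact_tok : ∀ j i, M (act j (p j i)) = Tpos j.val i := by
    intro j i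
    have e2 : ∃ jq : Fin (R + 1) × Fin N, act j (p j i) = act jq.1 jq.2 := ⟨(j, p j i), rfl⟩
    simp only [M, dif_neg (nAF j (p j i)), dif_pos e2]
    rw [hc2 j (p j i) e2]
    dsimp only
    have e3 : ∃ i', p j i' = p j i := ⟨i, rfl⟩
    rw [dif_pos e3, hcp j i e3]
  have hMact_junk : ∀ j q, (¬ ∃ i, p j i = q) → M (act j q) = tok j q := by
    intro j q hq
    have e2 : ∃ jq : Fin (R + 1) × Fin N, act j q = act jq.1 jq.2 := ⟨(j, q), rfl⟩
    simp only [M, dif_neg (nAF j q), dif_pos e2]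
    rw [hc2 j q e2]
    dsimp only
    rw [dif_neg hq]
  have hMtok_tok : ∀ j i, M (tok j (p j i)) = Apos (j.val + 1) i := by
    intro j i
    have e3 : ∃ jq : Fin (R + 1) × Fin N, tok j (p j i) = tok jq.1 jq.2 := ⟨(j, p j i), rfl⟩
    simp only [M, dif_neg (nTF j (p j i)), dif_neg (nTA j (p j i)), dif_pos e3]
    rw [hc3 j (p j i) e3]
    dsimp only
    have e4 : ∃ i', p j i' = p j i := ⟨i, rfl⟩
    rw [dif_pos e4, hcp j i e4]
  have hMtok_junk : ∀ j q, (¬ ∃ i, p j i = q) → M (tok j q) = act j q := by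
    intro j q hq
    have e3 : ∃ jq : Fin (R + 1) × Fin N, tok j q = tok jq.1 jq.2 := ⟨(j, q), rfl⟩
    simp only [M, dif_neg (nTF j q), dif_neg (nTA j q), dif_pos e3]
    rw [hc3 j q e3]
    dsimp only
    rw [dif_neg hq]
  have hMlast : ∀ i, M (last i) = tok ⟨R, by omega⟩ (p ⟨R, by omega⟩ i) := by
    intro i
    have e4 : ∃ i', last i = last i' := ⟨i, rfl⟩
    simp only [M, dif_neg (nLF i), dif_neg (nLA i), dif_neg (nLT i), dif_pos e4]
    rw [hc4 i e4]
    exact hTS ⟨R, by omega⟩ i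
  -- `M` on the token positions of layer `j`, and on their closers
  have hMTpos : ∀ (j : ℕ) (hj : j ≤ R + 1) i, M (Tpos j i) = Apos j i ∧ lay (Tpos j i) = 2 * j := by
    intro j hj i
    rcases j with _ | j
    · exact ⟨(hMfirst i).trans (hAj ⟨0, hR⟩ i).symm, by rw [hT0, h0]⟩
    · have hj' : j < R + 1 := by omega
      rw [hTS ⟨j, hj'⟩, hMtok_tok, hT]
      exact ⟨rfl, by dsimp only; omega⟩
  have hMApos : ∀ (j : ℕ) (hj : j ≤ R + 1) i, M (Apos j i) = Tpos j i ∧ lay (Apos j i) = 2 * j + 1 := by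
    intro j hj i
    rcases Nat.lt_or_ge j (R + 1) with h | h
    · rw [hAj ⟨j, h⟩, hMact_tok, hA]
      exact ⟨rfl, rfl⟩
    · have hjR : j = R + 1 := by omega
      subst hjR
      rw [hAR, hMlast, hL, ← hTS]
      exact ⟨rfl, by omega⟩
  -- every position: its partner, and the layer step
  have hall : ∀ a, M (M a) = a ∧ (lay (M a) = lay a + 1 ∨ lay a = lay (M a) + 1) := by
    intro a
    rcases hcov a with ⟨i, rfl⟩ | ⟨j, q, rfl⟩ | ⟨j, q, rfl⟩ | ⟨i, rfl⟩
    · obtain ⟨h1, h2⟩ := hMTpos 0 (by omega) i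
      obtain ⟨h3, h4⟩ := hMApos 0 (by omega) i
      rw [hT0] at h1 h2
      rw [h1, h3, hT0, h4, h2]
      exact ⟨rfl, Or.inl rfl⟩
    · by_cases hq : ∃ i, p j i = q
      · obtain ⟨i, rfl⟩ := hq
        obtain ⟨h1, h2⟩ := hMTpos j.val (by omega) i
        rw [hMact_tok, h1, hAj, h2, hA]
        exact ⟨rfl, Or.inr rfl⟩
      · rw [hMact_junk j q hq, hMtok_junk j q hq, hT, hA]
        exact ⟨rfl, Or.inl rfl⟩
    · by_cases hq : ∃ i, p j i = q
      · obtain ⟨i, rfl⟩ := hq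
        obtain ⟨h1, h2⟩ := hMApos (j.val + 1) (by omega) i
        rw [hMtok_tok, h1, hTS, h2, hT]
        exact ⟨rfl, Or.inl rfl⟩
      · rw [hMtok_junk j q hq, hMact_junk j q hq, hT, hA]
        exact ⟨rfl, Or.inr rfl⟩
    · obtain ⟨h1, h2⟩ := hMTpos (R + 1) le_rfl i
      obtain ⟨h3, h4⟩ := hMApos (R + 1) le_rfl i
      rw [hAR] at h3 h4
      rw [h3, h1, hAR, h2, h4]
      exact ⟨rfl, Or.inr rfl⟩
  have hinv : ∀ a, M (M a) = a := fun a => (hall a).1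
  have hfp : ∀ a, M a ≠ a := by
    intro a h
    rcases (hall a).2 with h' | h' <;> rw [h] at h' <;> omega
  have harcs : ∀ a, a < M a → lay (M a) = lay a + 1 := by
    intro a ha
    rcases (hall a).2 with h | h
    · exact h
    · exact absurd (lt_of_lay (by omega : lay (M a) < lay a)) (not_lt.2 ha.le)
  have hcloser : ∀ a, lay a = lay (M a) + 1 → ¬ a < M a := fun a h ha => by
    have := harcs a ha; omega
  refine ⟨M, hinv, hfp, (nonnest_iff_monotone_of_layered lay hmono hinv harcs).2 ?_, ?_⟩
  · -- increasing on the openers of each layer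
    intro a b hab ha hb hlab
    rcases hcov a with ⟨i, rfl⟩ | ⟨j, q, rfl⟩ | ⟨j, q, rfl⟩ | ⟨i, rfl⟩
    · -- layer 0
      rcases hcov b with ⟨i', rfl⟩ | ⟨j', q', rfl⟩ | ⟨j', q', rfl⟩ | ⟨i', rfl⟩
      · rw [hMfirst, hMfirst]
        exact hact _ (hp _ (hfirst.lt_iff_lt.1 hab))
      · rw [h0, hA] at hlab; omega
      · rw [h0, hT] at hlab; omega
      · rw [h0, hL] at hlab; omega
    · -- active layer: openers carry no token
      have hq : ¬ ∃ i, p j i = q := by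
        rintro ⟨i, rfl⟩
        refine hcloser _ ?_ ha
        obtain ⟨h1, h2⟩ := hMTpos j.val (by omega) i
        rw [hMact_tok, h2, hA]
      rw [hA] at hlab
      obtain ⟨q', rfl⟩ := eq_act_of_lay h0 hA hT hL hcov j.isLt hlab.symm
      have hq' : ¬ ∃ i, p j i = q' := by
        rintro ⟨i, rfl⟩
        refine hcloser _ ?_ hb
        obtain ⟨h1, h2⟩ := hMTpos j.val (by omega) i
        rw [hMact_tok, h2, hA]
      rw [hMact_junk j q hq, hMact_junk _ q' hq']
      exact htok _ ((hact _).lt_iff_lt.1 hab)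
    · -- token layer: openers carry a token
      have hq : ∃ i, p j i = q := by
        by_contra hq
        refine hcloser _ ?_ ha
        rw [hMtok_junk j q hq, hT, hA]
      obtain ⟨i, rfl⟩ := hq
      rw [hT] at hlab
      obtain ⟨q', rfl⟩ := eq_tok_of_lay h0 hA hT hL hcov j.isLt hlab.symm
      have hq' : ∃ i', p j i' = q' := by
        by_contra hq'
        refine hcloser _ ?_ hb
        rw [hMtok_junk _ q' hq', hT, hA]
      obtain ⟨i', rfl⟩ := hq'
      have hii' : i < i' := (hp _).lt_iff_lt.1 ((htok _).lt_iff_lt.1 hab)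
      rw [hMtok_tok, hMtok_tok]
      rcases Nat.lt_or_ge (j.val + 1) (R + 1) with h | h
      · rw [hAj ⟨j.val + 1, h⟩, hAj ⟨j.val + 1, h⟩]
        exact hact _ (hp _ hii')
      · have hj : j.val + 1 = R + 1 := by omega
        rw [hj, hAR, hAR]
        exact hlast hii'
    · -- the last layer has no opener
      exfalso
      refine hcloser _ ?_ ha
      obtain ⟨h3, h4⟩ := hMApos (R + 1) le_rfl i
      rw [hAR] at h3 h4
      obtain ⟨-, h2⟩ := hMTpos (R + 1) le_rfl i
      rw [h3, h2, h4]
  · -- all arcs are available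
    intro a ha
    rcases hcov a with ⟨i, rfl⟩ | ⟨j, q, rfl⟩ | ⟨j, q, rfl⟩ | ⟨i, rfl⟩
    · rw [hMfirst]; exact hx0 i
    · have hq : ¬ ∃ i, p j i = q := by
        rintro ⟨i, rfl⟩
        refine hcloser _ ?_ ha
        obtain ⟨h1, h2⟩ := hMTpos j.val (by omega) i
        rw [hMact_tok, h2, hA]
      rw [hMact_junk j q hq]; exact xC j q
    · have hq : ∃ i, p j i = q := by
        by_contra hq
        refine hcloser _ ?_ ha
        rw [hMtok_junk j q hq, hT, hA]
      obtain ⟨i, rfl⟩ := hq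
      rw [hMtok_tok]
      rcases Nat.lt_or_ge (j.val + 1) (R + 1) with h | h
      · rw [hAj ⟨j.val + 1, h⟩]; exact hxS j h i
      · have hjlt := j.isLt
        have hj2 : (⟨R + 1 - 1, by omega⟩ : Fin (R + 1)) = j := Fin.ext (by simp; omega)
        have hx := xE (p j i) i
        rw [hj2] at hx
        rw [show j.val + 1 = R + 1 by omega, hAR]
        exact hx
    · exfalso
      refine hcloser _ ?_ ha
      obtain ⟨h3, h4⟩ := hMApos (R + 1) le_rfl i
      rw [hAR] at h3 h4
      obtain ⟨-, h2⟩ := hMTpos (R + 1) le_rfl i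
      rw [h3, h2, h4]

/-- **The token game in the line's currency.**  For a round structure on `P = Fin (2n)` (both
hypothesis sets of `tokenPaths_of_matching` and `matching_of_tokenPaths`) and an arc vector
`x : σ n → Bool`, nest-free perfect-matching existence — the Boolean function of stub A,
`decide (SuppFn (NN n) {a | x a})` — holds iff there are `k` increasing token paths along available
arcs. [folklore] -/
theorem nfpmExists_iff_tokenPaths {n k R N : ℕ} (hR : 0 < R) {first : Fin k → Fin (2 * n)}
    {act tok : Fin R → Fin N → Fin (2 * n)} {last : Fin k → Fin (2 * n)} {lay : Fin (2 * n) → ℕ}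
    (hmono : Monotone lay)
    (h0 : ∀ i, lay (first i) = 0) (hA : ∀ j q, lay (act j q) = 2 * j + 1)
    (hT : ∀ j q, lay (tok j q) = 2 * j + 2) (hL : ∀ i, lay (last i) = 2 * R + 1)
    (hfirst : StrictMono first) (hact : ∀ j, StrictMono (act j)) (htok : ∀ j, StrictMono (tok j))
    (hlast : StrictMono last)
    (hcov : ∀ a, (∃ i, a = first i) ∨ (∃ j q, a = act j q) ∨ (∃ j q, a = tok j q) ∨ (∃ i, a = last i))
    (x : σ n → Bool)
    (xF : ∀ i b, first i < b → x (first i, b) = true → ∃ q, b = act ⟨0, hR⟩ q)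
    (xA : ∀ j q b, act j q < b → x (act j q, b) = true → b = tok j q)
    (xT : ∀ j q b, tok j q < b → x (tok j q, b) = true →
      (∃ h : j.val + 1 < R, ∃ q', b = act ⟨j.val + 1, h⟩ q') ∨ (j.val + 1 = R ∧ ∃ i, b = last i))
    (xL : ∀ i b, last i < b → x (last i, b) = true → False)
    (xC : ∀ j q, x (act j q, tok j q) = true)
    (xE : ∀ q i, x (tok ⟨R - 1, by omega⟩ q, last i) = true) :
    decide (SuppFn (NN n) (univ.filter fun a => x a = true)) = true ↔
      ∃ p : Fin R → Fin k → Fin N, (∀ j, StrictMono (p j)) ∧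
        (∀ i, x (first i, act ⟨0, hR⟩ (p ⟨0, hR⟩ i)) = true) ∧
        ∀ (j : Fin R) (h : j.val + 1 < R) (i : Fin k),
          x (tok j (p j i), act ⟨j.val + 1, h⟩ (p ⟨j.val + 1, h⟩ i)) = true := by
  rw [nfpmExists_eq_true_iff]
  constructor
  · rintro ⟨M, hM, hMx⟩
    obtain ⟨hperf, hnest⟩ := mem_nestFreeMatchings.1 hM
    obtain ⟨hinv, hfp⟩ := mem_perfectMatchings.1 hperf
    exact tokenPaths_of_matching hR hmono h0 hA hT hL hfirst hact htok hcov x xF xA xT xL hinv hfp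
      hnest hMx
  · rintro ⟨p, hp, hx0, hxS⟩
    obtain ⟨M, hinv, hfp, hnest, hon⟩ := matching_of_tokenPaths hR hmono h0 hA hT hL hfirst hact
      htok hlast hcov x xC xE p hp hx0 hxS
    exact ⟨M, mem_nestFreeMatchings.2 ⟨mem_perfectMatchings.2 ⟨hinv, hfp⟩, hnest⟩, hon⟩


end TokenGame

end Summit.ValiantsHypothesis.ValiantsHypothesis.Theorems.FifoMatching.NNNotVP.DivisionSplit

end
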